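import Mathlib
import HarnessLib
import Summits.HubbardSuperconductivity.HubbardSuperconductivity.Theorems.KLProgrammeC4aBubbleTubeRep
import Summits.HubbardSuperconductivity.HubbardSuperconductivity.Theorems.KLProgrammeC4aBubblePartition
import Summits.HubbardSuperconductivity.HubbardSuperconductivity.Theorems.KLProgrammeC4aLoopNondegeneracyPh

/-!
# Route `KLProgramme` — crux C4a, S3 brick (B3, REPRESENTATION, generic form + the ph ↦ pp HALF-TURN): every tube piece of the partition is a level
# integral of «profile × recentred loop integral», and the crossed (ph) bubble IS the direct (pp) bubble at the configuration `ϑ − π`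

Cell `gate-hubbard-kl`, seat hubbard-kl-k3c3-p3 (g24; row «implicit-function / monotonicity route»).  Last piece of the located brick «(B3)-ALL-ORDERS»
(stub (C) `stub_twoLeg_curvature` of `KLRegimeEngineV17F2`, stmt-HubbardSuperconductivity-20437; C4A-PLAN §24.8 (iii), §24.9 (ii)).  Two bookkeeping facts
that let the (B4)/(B5) closer call the pp files BY NAME for every piece of `…C4aBubblePartition(Ph)`:

* §1 **`tube_eq_levelIntegral_recentre`** — for a smooth level profile `f` with `tsupport f ⊆ (−r, r)` and ANY smooth `W : Momentum → ℂ`,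
  `∫_{tube} f(e_K q̂)·W(q̂) dq = ∫_{(−r,r)} f(e)·∫_{(−π,π)} J(e,φ+θ)·W(Φ(e,φ+θ)) dφ de` for every recentring angle `θ` (`tubeTadpole_eq_setIntegral_angularAvg` +
  `tubeAngular_recentre`; `bubbleTube_pp/ph_eq_levelIntegral` are the instances `W = Ψ∘e_K∘(S − ·)`, `Ψ∘e_K∘(· − D)`; the swapped / translated middle pieces
  of the partition are the instances `W = ((1−χ)Ψ₁)∘e_K∘(R − ·)`, `∘(· + D)`); `zoneBoxIco_profile_eq_levelIntegral` chains it with `setIntegral_zoneBox_eq_tube` (zone box → tube → level integral in one call).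
* §2 **the half-turn**: `e_K` is even (`frameLevel_neg`), so `Ψ(e_K(q̂ − D)) = Ψ(e_K(D − q̂))` and the crossed bubble at transfer momentum `D` is the direct
  bubble at pair momentum `D`; at the co-moving transfer momentum `D_{ρϑθ}(0) = S_{ρ,ϑ−π,θ}(0)` (`pairDiffPath_eq_pairSumPath_sub_pi`):
  `zoneBox_bubble_ph_eq_pp`, **`zoneBox_bubble_ph_comoving_eq_pp`** (as functions of the base angle `θ`, hence with all `θ`-jets:
  `iteratedDeriv_zoneBox_bubble_ph_eq_pp`) — the ph class of (B3)/(B4)/(B5) is the pp class read at `ϑ − π` (forward ↔ Cooper, `2k_F` ↔ tangency,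
  C4A-PLAN §24.8 (iii)).

Measure-theoretic bookkeeping on landed objects; nothing about the model's sizes; nothing asserts superconductivity.  References: FST II CPAM 51 (1998) §3;
BGM 2006 §2.4 (2.40) [cite: BenfattoGiulianiMastropietro2006].
-/

noncomputable section

namespace Summit.HubbardSuperconductivity.HubbardSuperconductivity.Theorems.C4a

set_option linter.dupNamespace false -- summit = problem name (single-conjunct summit), D-0017

open Real Set Filter MeasureTheory
open scoped Topology ContDiff
open Literature.MathematicalPhysics.QuantumLattice Literature.MathematicalPhysics.QuantumLattice.BandSectorCounting Literature.Probability.LatticeModels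
open Summit.HubbardSuperconductivity.HubbardSuperconductivity.Theorems.KLRegimeSplit
open Summit.HubbardSuperconductivity.HubbardSuperconductivity.Theorems.DispersionFlow
open Summit.HubbardSuperconductivity.HubbardSuperconductivity.Theorems.PerturbedFermiCurve

/-! ## §1 The generic tube representation with a recentred loop angle -/

section Rep

variable {a b : ℝ} (B : BandBounds a b) {K : TrigPolyC4v} {A : ℝ}
  (hA : ∀ p : Momentum, ∀ j ≤ 2, ‖iteratedFDeriv ℝ j (frameShift K) p‖ ≤ A) (hADt : 2 * A < B.Dtmin)
  {μ r : ℝ} (hlo : a < μ - r - A) (hhi : μ + r + A < b)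
include B hA hADt hlo hhi

/-- **THE TUBE PIECE AS A LEVEL INTEGRAL, generic vertex factor**: for a smooth level profile `f` supported in `(−r, r)` and any smooth
`W : Momentum → ℂ`, `∫_{tube} f(e_K q̂)·W(q̂) dq = ∫_{(−r,r)} f(e)·∫_{(−π,π)} J(e,φ+θ)·W(Φ(e,φ+θ)) dφ de` for every recentring angle `θ`. -/
theorem tube_eq_levelIntegral_recentre {f : ℝ → ℂ} (hf : ContDiff ℝ ∞ f) (hfsupp : tsupport f ⊆ Ioo (-r) r) {W : Momentum → ℂ} (hW : ContDiff ℝ ∞ W)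
    (θ : ℝ) :
    ∫ q in {q : ℝ × ℝ | |q.1| < π ∧ |q.2| < π ∧ |frameLevel μ K (WithLp.toLp 2 ![q.1, q.2])| < r},
        f (frameLevel μ K (WithLp.toLp 2 ![q.1, q.2])) * W (WithLp.toLp 2 ![q.1, q.2]) =
      ∫ e in Ioo (-r) r, f e * ∫ φ in Ioo (-π) π, levelChartJac μ K (e, φ + θ) • W (levelPoint μ K e (φ + θ)) := by
  have hV : ContDiff ℝ ∞ fun x : Momentum × Momentum => W x.2 := hW.comp contDiff_snd
  rw [tubeTadpole_eq_setIntegral_angularAvg B hA hADt hlo hhi hf hfsupp (V := fun _ q => W q) hV θ]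
  refine setIntegral_congr_fun measurableSet_Ioo fun e _ => ?_
  rw [tubeAngularAvg_apply, tubeAngular_recentre (fun q => W q) e θ]

/-- **Zone box → level integral in one call** (profile supported in the tube, any smooth vertex factor, any recentring angle):
`setIntegral_zoneBox_eq_tube` then §1. -/
theorem zoneBoxIco_profile_eq_levelIntegral {f : ℝ → ℂ} (hf : ContDiff ℝ ∞ f) (hfsupp : tsupport f ⊆ Ioo (-r) r) {W : Momentum → ℂ}
    (hW : ContDiff ℝ ∞ W) (θ : ℝ) :
    ∫ p in Ico (-π) π ×ˢ Ico (-π) π, f (frameLevel μ K (WithLp.toLp 2 ![p.1, p.2])) * W (WithLp.toLp 2 ![p.1, p.2]) =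
      ∫ e in Ioo (-r) r, f e * ∫ φ in Ioo (-π) π, levelChartJac μ K (e, φ + θ) • W (levelPoint μ K e (φ + θ)) := by
  rw [setIntegral_zoneBox_eq_tube μ K hfsupp W, tube_eq_levelIntegral_recentre B hA hADt hlo hhi hf hfsupp hW θ]

end Rep

/-! ## §2 The half-turn: the crossed bubble is the direct bubble at `ϑ − π` -/

section HalfTurn

/-- Evenness of the band under the partner: `e_K(q − D) = e_K(D − q)`. -/
theorem frameLevel_sub_comm (μ : ℝ) (K : TrigPolyC4v) (q D : Momentum) : frameLevel μ K (q - D) = frameLevel μ K (D - q) := by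
  rw [← neg_sub, frameLevel_neg]

/-- **The crossed bubble at transfer momentum `D` is the direct bubble at pair momentum `D`** (any integrand factors, any `D`). -/
theorem zoneBox_bubble_ph_eq_pp (μ : ℝ) (K : TrigPolyC4v) (Ψ₁ Ψ₂ : ℝ → ℂ) (D : Momentum) (s : Set (ℝ × ℝ)) :
    ∫ p in s, Ψ₁ (frameLevel μ K (WithLp.toLp 2 ![p.1, p.2])) * Ψ₂ (frameLevel μ K (WithLp.toLp 2 ![p.1, p.2] - D)) =
      ∫ p in s, Ψ₁ (frameLevel μ K (WithLp.toLp 2 ![p.1, p.2])) * Ψ₂ (frameLevel μ K (D - WithLp.toLp 2 ![p.1, p.2])) := by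
  simp only [frameLevel_sub_comm μ K _ D]

/-- The co-moving transfer momentum is the co-moving pair momentum of the half-turned configuration: `D_{ρϑθ}(0) = S_{ρ,ϑ−π,θ}(0)`. -/
theorem pairDiffPath_zero_eq_pairSumPath_sub_pi (μ : ℝ) (K : TrigPolyC4v) (ρ ϑ θ : ℝ) :
    pairDiffPath μ K ρ ϑ θ 0 = pairSumPath μ K ρ (ϑ - π) θ 0 :=
  pairDiffPath_eq_pairSumPath_sub_pi μ K ρ ϑ θ 0

/-- **THE CO-MOVING ph BUBBLE IS THE CO-MOVING pp BUBBLE AT `ϑ − π`, as functions of the base angle** (any integration set, any factors):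
`θ ↦ ∫ Ψ₁(e_K q̂)·Ψ₂(e_K(q̂ − D_{ρϑθ}(0)))` `=` `θ ↦ ∫ Ψ₁(e_K q̂)·Ψ₂(e_K(S_{ρ,ϑ−π,θ}(0) − q̂))`. -/
theorem zoneBox_bubble_ph_comoving_eq_pp (μ : ℝ) (K : TrigPolyC4v) (Ψ₁ Ψ₂ : ℝ → ℂ) (ρ ϑ : ℝ) (s : Set (ℝ × ℝ)) :
    (fun θ : ℝ => ∫ p in s, Ψ₁ (frameLevel μ K (WithLp.toLp 2 ![p.1, p.2])) * Ψ₂ (frameLevel μ K (WithLp.toLp 2 ![p.1, p.2] - pairDiffPath μ K ρ ϑ θ 0))) =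
      fun θ : ℝ => ∫ p in s, Ψ₁ (frameLevel μ K (WithLp.toLp 2 ![p.1, p.2])) * Ψ₂ (frameLevel μ K (pairSumPath μ K ρ (ϑ - π) θ 0 - WithLp.toLp 2 ![p.1, p.2])) := by
  funext θ
  rw [zoneBox_bubble_ph_eq_pp, pairDiffPath_zero_eq_pairSumPath_sub_pi]

/-- Hence every base-angle jet of the co-moving ph bubble is the corresponding jet of the co-moving pp bubble at `ϑ − π`. -/
theorem iteratedDeriv_zoneBox_bubble_ph_eq_pp (μ : ℝ) (K : TrigPolyC4v) (Ψ₁ Ψ₂ : ℝ → ℂ) (ρ ϑ : ℝ) (s : Set (ℝ × ℝ)) (k : ℕ) (θ : ℝ) :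
    iteratedDeriv k (fun θ : ℝ => ∫ p in s,
        Ψ₁ (frameLevel μ K (WithLp.toLp 2 ![p.1, p.2])) * Ψ₂ (frameLevel μ K (WithLp.toLp 2 ![p.1, p.2] - pairDiffPath μ K ρ ϑ θ 0))) θ =
      iteratedDeriv k (fun θ : ℝ => ∫ p in s,
        Ψ₁ (frameLevel μ K (WithLp.toLp 2 ![p.1, p.2])) * Ψ₂ (frameLevel μ K (pairSumPath μ K ρ (ϑ - π) θ 0 - WithLp.toLp 2 ![p.1, p.2]))) θ := by
  rw [zoneBox_bubble_ph_comoving_eq_pp]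

/-- The same for the loop-integral form of the ph partner band: `e_K(Φ(e,φ+θ) − D_{ρϑθ}(0)) = e_K(S_{ρ,ϑ−π,θ}(0) − Φ(e,φ+θ))`, so the ph loop integrand
of `…C4aBubbleTubeRep` is the pp loop integrand at `ϑ − π`. -/
theorem partnerBand_ph_eq_pp_halfTurn (μ : ℝ) (K : TrigPolyC4v) (ρ ϑ θ e φ : ℝ) :
    frameLevel μ K (levelPoint μ K e (φ + θ) - pairDiffPath μ K ρ ϑ θ 0) = frameLevel μ K (pairSumPath μ K ρ (ϑ - π) θ 0 - levelPoint μ K e (φ + θ)) := by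
  rw [frameLevel_sub_comm, pairDiffPath_zero_eq_pairSumPath_sub_pi]

/-- Along the co-moving flow (all angles shifted by `t`): `e_K(Φ(e,φ+θ+t) − D_{ρϑθ}(t)) = e_K(S_{ρ,ϑ−π,θ}(t) − Φ(e,φ+θ+t))` — the (B2) ph jets are (B2) pp
jets at `ϑ − π`. -/
theorem partnerBand_ph_flow_eq_pp_halfTurn (μ : ℝ) (K : TrigPolyC4v) (ρ ϑ θ e φ : ℝ) :
    (fun t : ℝ => frameLevel μ K (levelPoint μ K e (φ + θ + t) - pairDiffPath μ K ρ ϑ θ t)) =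
      fun t : ℝ => frameLevel μ K (pairSumPath μ K ρ (ϑ - π) θ t - levelPoint μ K e (φ + θ + t)) := by
  funext t
  rw [frameLevel_sub_comm, pairDiffPath_eq_pairSumPath_sub_pi]

end HalfTurn

end Summit.HubbardSuperconductivity.HubbardSuperconductivity.Theorems.C4a

end
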